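import Literature.Probability.RandomPlanarGeometry.ObservableAdapted
import Literature.Probability.RandomPlanarGeometry.SpinObservableDrivingMartingales
import Literature.Probability.Process.NaturalFiltrationMartingale
import HarnessLib

/-!
# The spin-Ising observable up to CDHKS's time horizon: continuous branch, optional stopping,
# and the two driving martingales from the cylinder identity

Topic `Probability/RandomPlanarGeometry` (deterministic Loewner calculus + a thin probabilistic
layer); theorems and two auxiliary definitions, no named fact. Spin-Ising companion of
`ObservableShortTime.lean`, `ObservableAdapted.lean` and the bridge section of
`LatticeModels/FKIsingNaturalMartingale.lean` (which treat the FK observable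
`(z g_t'(z)/(g_t(z) - W_t))^{1/2}` of Duminil-Copin–Smirnov), written for the **spin half of
crit-ising.S17** (Chelkak–Duminil-Copin–Hongler–Kemppainen–Smirnov, C. R. Math. 352 (2014),
Thm. 1; tree: `Literature.Probability.LatticeModels.isSLELaw_three_of_subseqLimit_spinInterface`
and the named fact (M) `Literature.Probability.LatticeModels.exists_drivingMartingales_of_subseqLimit_spinInterface`).
CDHKS, §3 (p. 7 of arXiv:1312.0533), for the spin observable
`M_t(z) = (∂_z[-G_t(w(z))⁻¹])^{1/2} = (G_t'(w)/G_t(w)²)^{1/2}`, `G_t = g_t - W_t`: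

> "for any `z ∈ Ω`, the process `M_t(z)`, `t ≤ T(z)`, where … `T(z) = (1/9)(Im w(z))²`, is a
> martingale with respect to the filtration `(𝓕_t)_{t≥0}` generated by `W_t`. … let
> `τ = τ(z)` be the first time such that `Im w(z) = 3(√τ + |W_τ|)` … Since (5)
> [`= M_{t∧τ}(z)`] is a martingale … both coefficients `W_t` and `W_t² - 3t` are martingales."

The tree's extraction theorem `Loewner.martingale_driver_of_spinObservable`
(`SpinObservableDrivingMartingales.lean`) starts from the *stopped* observable
`Loewner.stoppedSpinObservable W y` — the principal square root
`Loewner.spinObservable W t z = (z² g_t'(z)/(g_t(z) - W_t)²)^{1/2}` (`LoewnerFarField.lean`) at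
`z = iy` and at the stopped clock `t ∧ τ_y` — whereas the printed statement, and the form in
which it is inherited from discrete martingales by weak convergence, concern the observable *up
to the deterministic time `T(iy) = y²/9`* in the natural filtration of `W`. This file supplies
the passage between the two, exactly as `ObservableShortTime.lean` does for the FK observable,
with one difference forced by the algebra of the spin observable:

* **The continuous branch.** For `t ≤ y²/9` and an *unbounded* driver the spin density
  `(iy)² g_t'/G_t² = (iy g_t'/G_t) · (iy/G_t)` may cross the negative axis (its argument is
  `arg g_t' + 2 arg (iy/G_t)` with `|arg (iy/G_t)| < π/2` only), so the principal branch
  `Loewner.spinObservable` can jump in `t`. The branch of CDHKS's `M_t(z)` is the one continuous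
  in `t` from `M_0`; we realise it as the product of two principal square roots,
  `Loewner.contSpinObservable W t z = (z g_t'/G_t)^{1/2} · (z/G_t)^{1/2}`
  (`= Loewner.fkObservable W t z · (z/G_t)^{1/2}`), each of whose radicands stays in the slit
  plane for `z = iy`, `9t ≤ y²` (`ShortTime.base_mem_slitPlane` of `ObservableShortTime.lean`;
  `Re (iy/G_t) > 0`). PROVED: its square is the spin density (`contSpinObservable_sq`); it is
  continuous in `t ≤ y²/9` and bounded by `3` (`ShortTime.continuousOn_contSpinObservable`,
  `ShortTime.norm_contSpinObservable_le`: `‖g_t'‖ ≤ 2`, `‖G_t‖ ≥ 2y/3`); and **in the far-field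
  regime it coincides with the principal branch** (`FarRegime.contSpinObservable_eq`: both
  radicands have positive real part, so `log` of the product is the sum of the `log`s), hence
  with the object of `Loewner.stoppedSpinObservable` at the stopped clock.
* **The time-limited spin observable process** `Loewner.spinObservableProcess W y t ω =
  contSpinObservable (W · ω) (t ∧ y²/9) (iy)`: continuous paths, bounded by `3`, a measurable
  functional of the path up to time `t` (`measurable_spinObservableProcess`, from the tree's
  `measurable_map_of_im_pos`, `measurable_deriv_map`), hence adapted to every filtration to
  which `W` is adapted, in particular to the natural filtration of `W`
  (`stronglyAdapted_spinObservableProcess_natural`); and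
  `stoppedProcess (spinObservableProcess W y) τ_y = stoppedSpinObservable W y`
  (`stoppedProcess_spinObservableProcess`, as `τ_y ≤ (y/128)² ≤ y²/9`).
* **Optional stopping** (`martingale_re_stoppedSpinObservable`, `martingale_im_stoppedSpinObservable`):
  if `Re`/`Im` of the time-limited process is a martingale for a filtration to which `W`
  (continuous paths, `W_0 = 0`) is adapted, so is `Re`/`Im` of the stopped spin observable
  (the tree's `martingale_stoppedProcess_farStopTime`: Le Gall, Cor. 3.24, raw filtration).
* **Cylinder identity ⟹ natural-filtration martingales**
  (`martingale_re_im_spinObservableProcess_of_cylinder`): the monotone-class theorem of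
  `Process/NaturalFiltrationMartingale.lean`.
* **Assembly** (`martingale_driver_of_spinCylinderIdentity`, general probability space): if `W`
  has strongly measurable coordinates, continuous paths, `W_0 = 0`, running supremum in `L³` on
  every `[0, t]`, and for every `y > 0` the cylinder identity
  `E[(N^y_t - N^y_s) ψ(W_{S_0}, …, W_{S_{n-1}})] = 0` holds for the time-limited spin observable
  `N^y = spinObservableProcess W y`, all `s ≤ t`, `S ≤ s`, continuous `|ψ| ≤ 1`, then **`W_t` and
  `W_t² - 3t` are martingales in the natural filtration of `W`** — CDHKS's last paragraph of §3
  up to Lévy's theorem, in the form consumed by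
  `LatticeModels.isSLELaw_three_of_subseqLimit_spinInterface_of_exists_drivingMartingales`
  (`LatticeModels/InterfaceSLEFrontier.lean`).

Nothing here is specific to the Ising model: the lattice inputs of CDHKS's proof (convergence of
the driving processes, Kemppainen–Smirnov 2017; discrete fermionic observable martingale and its
convergence, Chelkak–Smirnov 2012, Thms 1.2, 5.6) enter only through the cylinder identity.

## Mathlib

USED: `Complex.cpow_def_of_ne_zero`, `Complex.log_mul_eq_add_log_iff`,
`Complex.abs_arg_lt_pi_div_two_iff` (branch bookkeeping); `ContinuousOn.cpow_const`,
`Complex.norm_cpow_real`; `Measurable.pow_const` (`MeasurablePow ℂ ℂ`);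
`MeasureTheory.stoppedProcess`, `Filtration.natural`, `Filtration.stronglyAdapted_natural`,
`Martingale`. From the tree: `Loewner.ShortTime` and its estimates, `Loewner.cdhksTime`,
`Loewner.farStopTime_le_cdhksTime`, `Loewner.martingale_stoppedProcess_farStopTime`
(`ObservableShortTime.lean`); `Loewner.measurable_fkObservable`, `measurable_map_of_im_pos`
(`ObservableAdapted.lean`, `LoewnerAdaptedPlane.lean`); `Loewner.FarRegime`,
`Loewner.spinObservable` (`LoewnerFarField.lean`); `Loewner.farRegime_stopped`,
`Loewner.stoppedSpinObservable`, `Loewner.martingale_driver_of_spinObservable`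
(`ObservableDrivingMartingales.lean`, `SpinObservableDrivingMartingales.lean`);
`Process.martingale_natural_of_integral_cylinder` (`Process/NaturalFiltrationMartingale.lean`).

## References

* D. Chelkak, H. Duminil-Copin, C. Hongler, A. Kemppainen, S. Smirnov, *Convergence of Ising
  interfaces to Schramm's SLE curves*, C. R. Math. Acad. Sci. Paris 352 (2014) 157–161
  (arXiv:1312.0533), §3 (p. 7): the displayed martingale claim, the stopping time `τ(z)`,
  eq. (5) and the last paragraph.
* D. Chelkak, S. Smirnov, *Universality in the 2D Ising model and conformal invariance of
  fermionic observables*, Invent. Math. 189 (2012) 515–580, Thms 1.2, 5.6 (the observable whose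
  scaling limit `M_t(z)` is).
* J.-F. Le Gall, *Brownian Motion, Martingales, and Stochastic Calculus* (2016), Cor. 3.24.
* D. Revuz, M. Yor, *Continuous Martingales and Brownian Motion* (1999), Ch. II §1.
-/

noncomputable section

open Set Filter Topology Metric MeasureTheory Complex
open scoped NNReal

namespace Literature.Probability.RandomPlanarGeometry

namespace Loewner

/-! ### The continuous branch of the spin observable -/

/-- **The spin-Ising half-plane observable, continuous branch**: for a driving function `W`,
time `t` and point `z`,
`contSpinObservable W t z = (z g_t'(z)/(g_t(z) - W_t))^{1/2} · (z/(g_t(z) - W_t))^{1/2}`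
(two principal square roots; the first factor is `Loewner.fkObservable W t z`). Its square is
the spin density `z² g_t'(z)/(g_t(z) - W_t)²` of CDHKS's `M_t(z) = (∂_z[-G_t(w)⁻¹])^{1/2}`,
`G_t = g_t - W_t` (times the `t`-independent factor `z²`), and on the imaginary axis, for
`9t ≤ (Im z)²`, both radicands stay in the slit plane, so that this is the branch of
`(z² g_t'/G_t²)^{1/2}` continuous in `t` from the value `1` at `t = 0` — the branch meant in
CDHKS (2014), §3 ("the process `M_t(z)`, `t ≤ T(z)`"). It agrees with the principal branch
`Loewner.spinObservable` in the far-field regime (`FarRegime.contSpinObservable_eq`). Junk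
outside the Loewner domain. [cite: CDHKSCRAS2014, §3] -/
def contSpinObservable (W : ℝ≥0 → ℝ) (t : ℝ≥0) (z : ℂ) : ℂ :=
  fkObservable W t z * (z / (map W t z - W t)) ^ (2⁻¹ : ℂ)

/-- `2⁻¹ = (↑2)⁻¹` with a natural-number cast (for `Complex.cpow_nat_inv_pow`). [folklore] -/
theorem two_inv_eq_natCast_inv : (2⁻¹ : ℂ) = ((2 : ℕ) : ℂ)⁻¹ := by norm_num

/-- **The square of the continuous branch is the spin density**:
`(contSpinObservable W t z)² = z² g_t'(z)/(g_t(z) - W_t)²`. [folklore] -/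
theorem contSpinObservable_sq (W : ℝ≥0 → ℝ) (t : ℝ≥0) (z : ℂ) :
    contSpinObservable W t z ^ 2 = z ^ 2 * deriv (map W t) z / (map W t z - W t) ^ 2 := by
  have h1 : fkObservable W t z ^ 2 = z * deriv (map W t) z / (map W t z - W t) := by
    rw [fkObservable, two_inv_eq_natCast_inv, cpow_nat_inv_pow _ two_ne_zero]
  have h2 : ((z / (map W t z - W t)) ^ (2⁻¹ : ℂ)) ^ 2 = z / (map W t z - W t) := by
    rw [two_inv_eq_natCast_inv, cpow_nat_inv_pow _ two_ne_zero]
  rw [contSpinObservable, mul_pow, h1, h2]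
  generalize map W t z - (W t : ℂ) = G
  ring

/-- The square of the principal branch is the same spin density:
`(spinObservable W t z)² = z² g_t'(z)/(g_t(z) - W_t)²`. [folklore] -/
theorem spinObservable_sq (W : ℝ≥0 → ℝ) (t : ℝ≥0) (z : ℂ) :
    spinObservable W t z ^ 2 = z ^ 2 * deriv (map W t) z / (map W t z - W t) ^ 2 := by
  rw [spinObservable, two_inv_eq_natCast_inv, cpow_nat_inv_pow _ two_ne_zero]

/-- The norm of a principal square root is the square root of the norm. [folklore] -/
theorem norm_cpow_two_inv (b : ℂ) : ‖b ^ (2⁻¹ : ℂ)‖ = Real.sqrt ‖b‖ := by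
  rw [show (2⁻¹ : ℂ) = ((2⁻¹ : ℝ) : ℂ) by norm_num, norm_cpow_real, Real.sqrt_eq_rpow, one_div]

namespace ShortTime

variable {W : ℝ≥0 → ℝ} {z : ℂ} {t : ℝ≥0}

/-- `s ↦ z/(g_s(z) - W_s)` is continuous on `[0, t]` in the short-time regime. [folklore] -/
theorem continuousOn_div_map_sub (h : ShortTime W z t) :
    ContinuousOn (fun s : ℝ≥0 ↦ z / (map W s z - W s)) (Icc 0 t) :=
  continuousOn_const.div (h.continuousOn_map.sub (continuous_ofReal.comp h.cont).continuousOn)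
    fun _ hs ↦ (h.mono hs.2).map_sub_ne_zero

/-- On the imaginary axis `iy/(g_t(iy) - W_t)` has positive real part (`Im (g_t - W_t) > 0`).
[folklore] -/
theorem re_div_map_sub_pos {y : ℝ} (h : ShortTime W (I * y) t) :
    0 < (I * y / (map W t (I * y) - W t)).re := by
  have hy : 0 < y := by simpa using h.im_pos
  exact re_I_mul_div_pos hy h.im_map_sub_pos

/-- On the imaginary axis `iy/(g_t(iy) - W_t)` lies in the slit plane. [folklore] -/
theorem div_map_sub_mem_slitPlane {y : ℝ} (h : ShortTime W (I * y) t) :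
    I * y / (map W t (I * y) - W t) ∈ slitPlane :=
  mem_slitPlane_iff.2 (Or.inl h.re_div_map_sub_pos)

/-- `‖iy/(g_t(iy) - W_t)‖ ≤ 3/2` in the short-time regime (`‖g_t - W_t‖ ≥ 2y/3`). [folklore] -/
theorem norm_div_map_sub_le {y : ℝ} (h : ShortTime W (I * y) t) :
    ‖I * y / (map W t (I * y) - W t)‖ ≤ 3 / 2 := by
  have hy : 0 < y := by simpa using h.im_pos
  have hG := h.norm_map_sub_lower
  have hIy : (I * (y : ℂ)).im = y := by simp
  rw [hIy] at hG
  have hG0 : 0 < ‖map W t (I * y) - W t‖ := by linarith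
  rw [norm_div, div_le_iff₀ hG0]
  have h1 : ‖I * (y : ℂ)‖ = y := by simp [abs_of_pos hy]
  rw [h1]
  linarith

/-- **The continuous branch `s ↦ contSpinObservable W s (iy)` is continuous on `[0, t]`** in the
short-time regime `9t ≤ y²`: both radicands stay in the slit plane. (CDHKS 2014, §3: "`M_t^δ(z)`
are … equicontinuous … if `t ≤ (1/9)(Im w(z))²`".) [cite: CDHKSCRAS2014, §3] -/
theorem continuousOn_contSpinObservable {y : ℝ} (h : ShortTime W (I * y) t) :
    ContinuousOn (fun s : ℝ≥0 ↦ contSpinObservable W s (I * y)) (Icc 0 t) :=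
  h.continuousOn_fkObservable.mul
    (h.continuousOn_div_map_sub.cpow_const fun _ hs ↦ (h.mono hs.2).div_map_sub_mem_slitPlane)

/-- **The continuous branch is bounded by `3`** on the imaginary axis in the short-time regime:
`‖(iy g'/(g - W))^{1/2}‖ ≤ 2` and `‖(iy/(g - W))^{1/2}‖ ≤ (3/2)^{1/2} ≤ 3/2`. (CDHKS 2014, §3:
"`M_t^δ(z)` are uniformly bounded … if `t ≤ (1/9)(Im w(z))²`".) [cite: CDHKSCRAS2014, §3] -/
theorem norm_contSpinObservable_le {y : ℝ} (h : ShortTime W (I * y) t) :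
    ‖contSpinObservable W t (I * y)‖ ≤ 3 := by
  set b := I * y / (map W t (I * y) - W t) with hb
  have hq : ‖b ^ (2⁻¹ : ℂ)‖ ≤ 3 / 2 := by
    rw [norm_cpow_two_inv]
    calc Real.sqrt ‖b‖ ≤ Real.sqrt (9 / 4) :=
          Real.sqrt_le_sqrt (by linarith [h.norm_div_map_sub_le])
      _ = 3 / 2 := by
          rw [show (9 / 4 : ℝ) = (3 / 2) ^ 2 by norm_num, Real.sqrt_sq (by norm_num)]
  rw [contSpinObservable, ← hb, norm_mul]
  calc ‖fkObservable W t (I * y)‖ * ‖b ^ (2⁻¹ : ℂ)‖ ≤ 2 * (3 / 2) :=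
        mul_le_mul h.norm_fkObservable_le hq (norm_nonneg _) (by norm_num)
    _ = 3 := by norm_num

end ShortTime

variable {W : ℝ≥0 → ℝ}

/-- **The time-limited path `s ↦ contSpinObservable W (s ∧ T(iy)) (iy)` is continuous on
`[0, ∞)`** (`W` continuous, `y > 0`, `T(iy) = y²/9`). [folklore] -/
theorem continuous_contSpinObservable_min (hW : Continuous W) {y : ℝ} (hy : 0 < y) :
    Continuous fun s : ℝ≥0 ↦ contSpinObservable W (min s (cdhksTime y)) (I * y) :=
  (shortTime_cdhksTime hW hy).continuousOn_contSpinObservable.comp_continuous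
    (continuous_id.min continuous_const) fun _ ↦ ⟨bot_le, min_le_right _ _⟩

/-- The time-limited continuous branch is bounded by `3`. [folklore] -/
theorem norm_contSpinObservable_min_le (hW : Continuous W) {y : ℝ} (hy : 0 < y) (s : ℝ≥0) :
    ‖contSpinObservable W (min s (cdhksTime y)) (I * y)‖ ≤ 3 :=
  (shortTime_min_cdhksTime hW hy s).norm_contSpinObservable_le

/-! ### In the far-field regime the continuous branch is the principal branch -/

namespace FarRegime

variable {z : ℂ} {t : ℝ≥0} {K : ℝ}

/-- The relative displacement of `G_t = g_t(z) - W_t` from `z` is at most `2α`: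
`‖(G_t - z)/z‖ ≤ 2 (K + √t)/‖z‖` (`FarRegime.norm_u_le` at `s = t`). [folklore] -/
theorem norm_map_sub_sub_div_le (h : FarRegime W z t K) :
    ‖(map W t z - W t - z) / z‖ ≤ 2 * ((K + Real.sqrt t) / ‖z‖) := by
  obtain ⟨g, hg⟩ := h.exists_sol
  have := h.norm_u_le hg (s := t) ⟨t.coe_nonneg, le_rfl⟩
  rwa [← h.map_eq hg ⟨t.coe_nonneg, le_rfl⟩, Real.toNNReal_coe] at this

/-- `z/G_t` is within `4α ≤ 1/16` of `1` in the far-field regime. [folklore] -/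
theorem norm_div_map_sub_sub_one_le (h : FarRegime W z t K) :
    ‖z / (map W t z - W t) - 1‖ ≤ 4 * ((K + Real.sqrt t) / ‖z‖) := by
  set u := (map W t z - W t - z) / z with hu
  have hα := h.alpha_le
  have h1 : ‖u‖ ≤ 2 * ((K + Real.sqrt t) / ‖z‖) := h.norm_map_sub_sub_div_le
  have h2 : ‖u‖ ≤ 1 / 2 := by linarith
  have hz := h.z_ne_zero
  have hG : map W t z - W t = z * (1 + u) := by
    rw [hu]; field_simp; ring
  have hb : z / (map W t z - W t) = (1 + u)⁻¹ := by
    rw [hG, div_mul_eq_div_div, div_self hz, one_div]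
  rw [hb]
  linarith [norm_inv_one_add_sub_one_le h2]

/-- `Re (z/G_t) > 0` in the far-field regime. [folklore] -/
theorem re_div_map_sub_pos (h : FarRegime W z t K) : 0 < (z / (map W t z - W t)).re := by
  have h1 := h.norm_div_map_sub_sub_one_le
  have hα := h.alpha_le
  have h2 : |(z / (map W t z - W t) - 1).re| ≤ ‖z / (map W t z - W t) - 1‖ := abs_re_le_norm _
  rw [sub_re, one_re] at h2
  have h3 := (abs_le.1 h2).1
  linarith

/-- `Re (z g_t'/G_t) > 0` in the far-field regime (the FK density is within `1/32` of `1`).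
[folklore] -/
theorem re_density_pos (h : FarRegime W z t K) :
    0 < (z * deriv (map W t) z / (map W t z - W t)).re := by
  have h1 := h.norm_density_sub_one_le
  have hα := h.alpha_le
  have h2 : |(z * deriv (map W t) z / (map W t z - W t) - 1).re| ≤
      ‖z * deriv (map W t) z / (map W t z - W t) - 1‖ := abs_re_le_norm _
  rw [sub_re, one_re] at h2
  have h3 := (abs_le.1 h2).1
  linarith

/-- **In the far-field regime the continuous branch is the principal branch**:
`contSpinObservable W t z = spinObservable W t z`. Both radicands `a = z g_t'/G_t` and `b = z/G_t`
have positive real part, so `|arg a| + |arg b| < π`, `log (ab) = log a + log b` and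
`(ab)^{1/2} = a^{1/2} b^{1/2}`. [folklore] -/
theorem contSpinObservable_eq (h : FarRegime W z t K) :
    contSpinObservable W t z = spinObservable W t z := by
  unfold contSpinObservable spinObservable fkObservable
  set a := z * deriv (map W t) z / (map W t z - W t) with ha
  set b := z / (map W t z - W t) with hb
  have hare : 0 < a.re := h.re_density_pos
  have hbre : 0 < b.re := h.re_div_map_sub_pos
  have ha0 : a ≠ 0 := fun h0 ↦ by rw [h0, zero_re] at hare; exact lt_irrefl _ hare
  have hb0 : b ≠ 0 := fun h0 ↦ by rw [h0, zero_re] at hbre; exact lt_irrefl _ hbre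
  have harg : arg a + arg b ∈ Set.Ioc (-Real.pi) Real.pi := by
    have h1 := abs_lt.1 (abs_arg_lt_pi_div_two_iff.2 (Or.inl hare))
    have h2 := abs_lt.1 (abs_arg_lt_pi_div_two_iff.2 (Or.inl hbre))
    constructor <;> linarith
  have hD : z ^ 2 * deriv (map W t) z / (map W t z - W t) ^ 2 = a * b := by
    rw [ha, hb]
    generalize map W t z - (W t : ℂ) = G
    ring
  rw [hD, cpow_def_of_ne_zero (mul_ne_zero ha0 hb0), cpow_def_of_ne_zero ha0,
    cpow_def_of_ne_zero hb0, (log_mul_eq_add_log_iff ha0 hb0).2 harg, add_mul, exp_add]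

end FarRegime

end Loewner

end Literature.Probability.RandomPlanarGeometry

/-! ## The time-limited spin observable process, optional stopping, and the cylinder identity -/

namespace Literature.Probability.RandomPlanarGeometry

namespace Loewner

open Literature.Probability.Process

variable {Ω : Type*} {m : MeasurableSpace Ω}

/-- **The time-limited spin observable process** at the point `iy`:
`spinObservableProcess W y t ω = contSpinObservable (W · ω) (t ∧ y²/9) (iy)`, the continuous
branch of `((iy)² g_t'(iy)/(g_t(iy) - W_t)²)^{1/2}` for the Loewner chain of the path `W · ω`,
frozen at CDHKS's time horizon `T(iy) = y²/9` (`Loewner.cdhksTime`). This is (`iy` times) the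
process "`M_t(z) = (∂_z[-G_t(w(z))⁻¹])^{1/2}`, `t ≤ T(z)`" of CDHKS (2014), §3, read at the
half-plane point `w = iy`. [cite: CDHKSCRAS2014, §3] -/
def spinObservableProcess (W : ℝ≥0 → Ω → ℝ) (y : ℝ) : ℝ≥0 → Ω → ℂ :=
  fun t ω ↦ contSpinObservable (fun u ↦ W u ω) (min t (cdhksTime y)) (I * y)

/-- Unfolding of `spinObservableProcess`. [folklore] -/
theorem spinObservableProcess_apply (W : ℝ≥0 → Ω → ℝ) (y : ℝ) (t : ℝ≥0) (ω : Ω) :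
    spinObservableProcess W y t ω =
      contSpinObservable (fun u ↦ W u ω) (min t (cdhksTime y)) (I * y) := rfl

variable {W : ℝ≥0 → Ω → ℝ}

/-- **The time-limited spin observable process has continuous paths** (every `ω`; `W` with
continuous paths, `y > 0`). [folklore] -/
theorem continuous_spinObservableProcess (hWc : ∀ ω, Continuous (W · ω)) {y : ℝ} (hy : 0 < y)
    (ω : Ω) : Continuous fun t ↦ spinObservableProcess W y t ω :=
  continuous_contSpinObservable_min (hWc ω) hy

/-- The time-limited spin observable process is bounded by `3`. [folklore] -/
theorem norm_spinObservableProcess_le (hWc : ∀ ω, Continuous (W · ω)) {y : ℝ} (hy : 0 < y)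
    (t : ℝ≥0) (ω : Ω) : ‖spinObservableProcess W y t ω‖ ≤ 3 :=
  norm_contSpinObservable_min_le (hWc ω) hy t

/-- **Stopping the time-limited spin observable at `τ_y` gives the stopped spin observable** of
`SpinObservableDrivingMartingales.lean`:
`(spinObservableProcess W y)_{t ∧ τ_y} = stoppedSpinObservable W y t`, because `τ_y ≤ T(iy)`
and, at the stopped clock, the path is in the far-field regime, where the continuous branch is
the principal branch (`FarRegime.contSpinObservable_eq`). (`W` with continuous paths, `W_0 = 0`,
`y > 0`.) [folklore] -/
theorem stoppedProcess_spinObservableProcess (hWc : ∀ ω, Continuous (W · ω))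
    (hW0 : ∀ ω, W 0 ω = 0) {y : ℝ} (hy : 0 < y) :
    stoppedProcess (spinObservableProcess W y) (farStopTime W y) = stoppedSpinObservable W y := by
  ext t ω
  simp only [stoppedProcess, spinObservableProcess_apply, stoppedSpinObservable]
  have hσ : min (min (t : WithTop ℝ≥0) (farStopTime W y ω)).untopA (cdhksTime y) =
      (min (t : WithTop ℝ≥0) (farStopTime W y ω)).untopA := by
    refine min_eq_left ?_
    have h1 := coe_untopA_min_le t (farStopTime W y ω)
    exact WithTop.coe_le_coe.1 (h1.trans (farStopTime_le_cdhksTime hWc y ω))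
  rw [hσ]
  obtain ⟨C, hC⟩ := (isCompact_Icc (a := (0 : ℝ≥0)) (b := t)).exists_bound_of_continuousOn
    (hWc ω).continuousOn
  have hM : ∀ u, u ≤ t → |W u ω| ≤ C := fun u hu ↦ by
    have := hC u ⟨bot_le, hu⟩
    rwa [Real.norm_eq_abs] at this
  exact (farRegime_stopped hWc hW0 hy hM le_rfl).contSpinObservable_eq

/-- Real part of the stopping identity. [folklore] -/
theorem stoppedProcess_re_spinObservableProcess (hWc : ∀ ω, Continuous (W · ω))
    (hW0 : ∀ ω, W 0 ω = 0) {y : ℝ} (hy : 0 < y) :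
    stoppedProcess (fun t ω ↦ (spinObservableProcess W y t ω).re) (farStopTime W y) =
      fun t ω ↦ (stoppedSpinObservable W y t ω).re := by
  ext t ω
  have := congrFun (congrFun (stoppedProcess_spinObservableProcess hWc hW0 hy) t) ω
  simp only [stoppedProcess] at this ⊢
  rw [this]

/-- Imaginary part of the stopping identity. [folklore] -/
theorem stoppedProcess_im_spinObservableProcess (hWc : ∀ ω, Continuous (W · ω))
    (hW0 : ∀ ω, W 0 ω = 0) {y : ℝ} (hy : 0 < y) :
    stoppedProcess (fun t ω ↦ (spinObservableProcess W y t ω).im) (farStopTime W y) =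
      fun t ω ↦ (stoppedSpinObservable W y t ω).im := by
  ext t ω
  have := congrFun (congrFun (stoppedProcess_spinObservableProcess hWc hW0 hy) t) ω
  simp only [stoppedProcess] at this ⊢
  rw [this]

/-! ### Measurability and adaptedness -/

/-- **The continuous branch `contSpinObservable (W · ω) t (iy)` is a measurable functional of
the driving path up to time `t`** (`9t ≤ y²`, `y > 0`): the FK factor by
`measurable_fkObservable`, the factor `(iy/(g_t(iy) - W_t))^{1/2}` by `measurable_map_of_im_pos`
and measurability of the principal power. [folklore] -/
theorem measurable_contSpinObservable (hWc : ∀ ω, Continuous (W · ω)) {t : ℝ≥0}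
    (hmeas : ∀ s, s ≤ t → Measurable fun ω ↦ W s ω) {y : ℝ} (hy : 0 < y)
    (h9 : 9 * (t : ℝ) ≤ y ^ 2) :
    Measurable fun ω ↦ contSpinObservable (fun u ↦ W u ω) t (I * y) := by
  have hz : 0 < (I * (y : ℂ)).im := by simpa using hy
  have hmz : Measurable fun ω ↦ map (fun u ↦ W u ω) t (I * y) :=
    measurable_map_of_im_pos (W := fun ω u ↦ W u ω) hWc hmeas hz
  have hW : Measurable fun ω ↦ ((W t ω : ℝ) : ℂ) := measurable_ofReal.comp (hmeas t le_rfl)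
  have hf := measurable_fkObservable hWc hmeas hy h9
  unfold contSpinObservable
  exact hf.mul ((measurable_const.div (hmz.sub hW)).pow_const _)

/-- **The time-limited spin observable process is a measurable functional of the driving path up
to the present**: `ω ↦ N^y_t(ω)` is measurable for any σ-algebra making `W_s`, `s ≤ t`,
measurable. [folklore] -/
theorem measurable_spinObservableProcess (hWc : ∀ ω, Continuous (W · ω)) {t : ℝ≥0}
    (hmeas : ∀ s, s ≤ t → Measurable fun ω ↦ W s ω) {y : ℝ} (hy : 0 < y) :
    Measurable (spinObservableProcess W y t) := by
  have h9 : 9 * ((min t (cdhksTime y) : ℝ≥0) : ℝ) ≤ y ^ 2 := by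
    have h1 : ((min t (cdhksTime y) : ℝ≥0) : ℝ) ≤ (cdhksTime y : ℝ) :=
      NNReal.coe_le_coe.2 (min_le_right _ _)
    rw [coe_cdhksTime] at h1
    linarith
  exact measurable_contSpinObservable (t := min t (cdhksTime y)) hWc
    (fun s hs ↦ hmeas s (hs.trans (min_le_left _ _))) hy h9

/-- **The time-limited spin observable process is adapted** to every filtration to which `W`
(continuous paths) is adapted. [folklore] -/
theorem stronglyAdapted_spinObservableProcess {𝓕 : Filtration ℝ≥0 m} (hWad : StronglyAdapted 𝓕 W)
    (hWc : ∀ ω, Continuous (W · ω)) {y : ℝ} (hy : 0 < y) :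
    StronglyAdapted 𝓕 (spinObservableProcess W y) := fun t ↦
  (measurable_spinObservableProcess (m := 𝓕 t) hWc
    (fun s hs ↦ ((hWad s).mono (𝓕.mono hs)).measurable) hy).stronglyMeasurable

/-- Real part: adaptedness. [folklore] -/
theorem stronglyAdapted_re_spinObservableProcess {𝓕 : Filtration ℝ≥0 m}
    (hWad : StronglyAdapted 𝓕 W) (hWc : ∀ ω, Continuous (W · ω)) {y : ℝ} (hy : 0 < y) :
    StronglyAdapted 𝓕 (fun t ω ↦ (spinObservableProcess W y t ω).re) := fun t ↦
  (measurable_re.comp (measurable_spinObservableProcess (m := 𝓕 t) hWc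
    (fun s hs ↦ ((hWad s).mono (𝓕.mono hs)).measurable) hy)).stronglyMeasurable

/-- Imaginary part: adaptedness. [folklore] -/
theorem stronglyAdapted_im_spinObservableProcess {𝓕 : Filtration ℝ≥0 m}
    (hWad : StronglyAdapted 𝓕 W) (hWc : ∀ ω, Continuous (W · ω)) {y : ℝ} (hy : 0 < y) :
    StronglyAdapted 𝓕 (fun t ω ↦ (spinObservableProcess W y t ω).im) := fun t ↦
  (measurable_im.comp (measurable_spinObservableProcess (m := 𝓕 t) hWc
    (fun s hs ↦ ((hWad s).mono (𝓕.mono hs)).measurable) hy)).stronglyMeasurable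

/-- **Adaptedness to the natural filtration of the driving process** (the filtration "generated
by `W_t`" of CDHKS 2014, §3): the time-limited spin observable process and its real and
imaginary parts are adapted to `Filtration.natural W`. [cite: CDHKSCRAS2014, §3] -/
theorem stronglyAdapted_spinObservableProcess_natural (hW : ∀ t, StronglyMeasurable (W t))
    (hWc : ∀ ω, Continuous (W · ω)) {y : ℝ} (hy : 0 < y) :
    StronglyAdapted (Filtration.natural W hW) (spinObservableProcess W y) ∧
    StronglyAdapted (Filtration.natural W hW) (fun t ω ↦ (spinObservableProcess W y t ω).re) ∧
    StronglyAdapted (Filtration.natural W hW) (fun t ω ↦ (spinObservableProcess W y t ω).im) :=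
  ⟨stronglyAdapted_spinObservableProcess (Filtration.stronglyAdapted_natural hW) hWc hy,
    stronglyAdapted_re_spinObservableProcess (Filtration.stronglyAdapted_natural hW) hWc hy,
    stronglyAdapted_im_spinObservableProcess (Filtration.stronglyAdapted_natural hW) hWc hy⟩

/-! ### Optional stopping at `τ_y` -/

section Martingale

variable {P : Measure Ω} [IsFiniteMeasure P] {𝓕 : Filtration ℝ≥0 m}

/-- **From CDHKS's martingale to the stopped spin observable martingale, real part.** If the real
part of the time-limited spin observable process `t ↦ Re N^y_t` is an `𝓕`-martingale (`W`
`𝓕`-adapted with continuous paths, `W_0 = 0`, `y > 0`), then so is the real part of the stopped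
spin observable `t ↦ Re (stoppedSpinObservable W y t)` (CDHKS 2014, §3: from "`M_t(z)`,
`t ≤ T(z)`, is a martingale" to "(5) [`= M_{t∧τ}(z)`] is a martingale"), by optional stopping
for martingales with continuous paths in a raw filtration
(`martingale_stoppedProcess_farStopTime`). [cite: CDHKSCRAS2014, §3] -/
theorem martingale_re_stoppedSpinObservable (hWad : StronglyAdapted 𝓕 W)
    (hWc : ∀ ω, Continuous (W · ω)) (hW0 : ∀ ω, W 0 ω = 0) {y : ℝ} (hy : 0 < y)
    (h : Martingale (fun t ω ↦ (spinObservableProcess W y t ω).re) 𝓕 P) :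
    Martingale (fun t ω ↦ (stoppedSpinObservable W y t ω).re) 𝓕 P := by
  rw [← stoppedProcess_re_spinObservableProcess hWc hW0 hy]
  exact martingale_stoppedProcess_farStopTime hWad hWc y h
    fun ω ↦ continuous_re.comp (continuous_spinObservableProcess hWc hy ω)

/-- **From CDHKS's martingale to the stopped spin observable martingale, imaginary part.**
[cite: CDHKSCRAS2014, §3] -/
theorem martingale_im_stoppedSpinObservable (hWad : StronglyAdapted 𝓕 W)
    (hWc : ∀ ω, Continuous (W · ω)) (hW0 : ∀ ω, W 0 ω = 0) {y : ℝ} (hy : 0 < y)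
    (h : Martingale (fun t ω ↦ (spinObservableProcess W y t ω).im) 𝓕 P) :
    Martingale (fun t ω ↦ (stoppedSpinObservable W y t ω).im) 𝓕 P := by
  rw [← stoppedProcess_im_spinObservableProcess hWc hW0 hy]
  exact martingale_stoppedProcess_farStopTime hWad hWc y h
    fun ω ↦ continuous_im.comp (continuous_spinObservableProcess hWc hy ω)

end Martingale

/-! ### The cylinder identity gives the natural-filtration martingales -/

section Bridge

variable {P : Measure Ω} [IsFiniteMeasure P]

/-- The time-limited spin observable is integrable on a finite measure space (bounded by `3` and
measurable). [folklore] -/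
theorem integrable_spinObservableProcess (hW : ∀ t, StronglyMeasurable (W t))
    (hWc : ∀ ω, Continuous (W · ω)) {y : ℝ} (hy : 0 < y) (t : ℝ≥0) :
    Integrable (spinObservableProcess W y t) P := by
  have hmeas : Measurable (spinObservableProcess W y t) :=
    measurable_spinObservableProcess hWc (fun s _ ↦ (hW s).measurable) hy
  exact (integrable_const (3 : ℝ)).mono' hmeas.aestronglyMeasurable
    (ae_of_all _ fun ω ↦ norm_spinObservableProcess_le hWc hy t ω)

/-- The cylinder integrand `(N_t - N_s) ψ(W_S)` is integrable (bounded by `6`, measurable).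
[folklore] -/
theorem integrable_spinCylinderIntegrand (hW : ∀ t, StronglyMeasurable (W t))
    (hWc : ∀ ω, Continuous (W · ω)) {y : ℝ} (hy : 0 < y) (s t : ℝ≥0) {n : ℕ} (S : Fin n → ℝ≥0)
    {ψ : (Fin n → ℝ) → ℝ} (hψc : Continuous ψ) (hψ1 : ∀ v, |ψ v| ≤ 1) :
    Integrable (fun ω ↦ (spinObservableProcess W y t ω - spinObservableProcess W y s ω) *
      (ψ (fun k ↦ W (S k) ω) : ℂ)) P := by
  have hV : Measurable fun ω ↦ (fun k ↦ W (S k) ω : Fin n → ℝ) :=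
    measurable_pi_lambda _ fun k ↦ (hW (S k)).measurable
  have hψm : Measurable fun ω ↦ (ψ (fun k ↦ W (S k) ω) : ℂ) :=
    measurable_ofReal.comp (hψc.measurable.comp hV)
  have hN := fun r ↦ measurable_spinObservableProcess (t := r) hWc (fun u _ ↦ (hW u).measurable) hy
  refine (integrable_const (6 : ℝ)).mono' (((hN t).sub (hN s)).mul hψm).aestronglyMeasurable
    (ae_of_all _ fun ω ↦ ?_)
  rw [norm_mul, Complex.norm_real, Real.norm_eq_abs]
  have ht := norm_spinObservableProcess_le hWc hy t ω
  have hs := norm_spinObservableProcess_le hWc hy s ω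
  have h1 : ‖spinObservableProcess W y t ω - spinObservableProcess W y s ω‖ ≤ 6 :=
    (norm_sub_le _ _).trans (by linarith)
  have h2 := hψ1 (fun k ↦ W (S k) ω)
  calc ‖spinObservableProcess W y t ω - spinObservableProcess W y s ω‖ * |ψ fun k ↦ W (S k) ω|
      ≤ 6 * 1 := mul_le_mul h1 h2 (abs_nonneg _) (by norm_num)
    _ = 6 := by norm_num

/-- **Real and imaginary parts of the time-limited spin observable are natural-filtration
martingales as soon as the complex cylinder identity holds** — CDHKS's "`M_t(z)`, `t ≤ T(z)`,
is a martingale with respect to the filtration generated by `W_t`" in monotone-class form: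
adaptedness (`stronglyAdapted_spinObservableProcess_natural`) and the monotone-class theorem
(`Process.martingale_natural_of_integral_cylinder`), after taking real and imaginary parts of
the complex identity. [cite: CDHKSCRAS2014, §3] -/
theorem martingale_re_im_spinObservableProcess_of_cylinder (hW : ∀ t, StronglyMeasurable (W t))
    (hWc : ∀ ω, Continuous (W · ω)) {y : ℝ} (hy : 0 < y)
    (h : ∀ s t : ℝ≥0, s ≤ t → ∀ (n : ℕ) (S : Fin n → ℝ≥0), (∀ k, S k ≤ s) →
      ∀ ψ : (Fin n → ℝ) → ℝ, Continuous ψ → (∀ v, |ψ v| ≤ 1) →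
        ∫ ω, (spinObservableProcess W y t ω - spinObservableProcess W y s ω) *
          (ψ (fun k ↦ W (S k) ω) : ℂ) ∂P = 0) :
    Martingale (fun t ω ↦ (spinObservableProcess W y t ω).re) (Filtration.natural W hW) P ∧
    Martingale (fun t ω ↦ (spinObservableProcess W y t ω).im) (Filtration.natural W hW) P := by
  obtain ⟨-, hre, him⟩ := stronglyAdapted_spinObservableProcess_natural hW hWc hy
  have hint := fun t ↦ integrable_spinObservableProcess (P := P) hW hWc hy t
  constructor
  · refine Process.martingale_natural_of_integral_cylinder hW hre (fun t ↦ (hint t).re)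
      fun s t hst n S hS ψ hψc hψ1 ↦ ?_
    have hI := integrable_spinCylinderIntegrand (P := P) hW hWc hy s t S hψc hψ1
    have h0 := h s t hst n S hS ψ hψc hψ1
    have h1 := integral_re hI
    simp only [RCLike.re_to_complex, h0, Complex.zero_re] at h1
    rw [← h1]
    refine integral_congr_ae (ae_of_all _ fun ω ↦ ?_)
    simp only [Complex.re_mul_ofReal, Complex.sub_re]
  · refine Process.martingale_natural_of_integral_cylinder hW him (fun t ↦ (hint t).im)
      fun s t hst n S hS ψ hψc hψ1 ↦ ?_
    have hI := integrable_spinCylinderIntegrand (P := P) hW hWc hy s t S hψc hψ1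
    have h0 := h s t hst n S hS ψ hψc hψ1
    have h1 := integral_im hI
    simp only [RCLike.im_to_complex, h0, Complex.zero_im] at h1
    rw [← h1]
    refine integral_congr_ae (ae_of_all _ fun ω ↦ ?_)
    simp only [Complex.im_mul_ofReal, Complex.sub_im]

end Bridge

/-! ### Assembly: the two driving martingales from the cylinder identity -/

section Assembly

variable {P : Measure Ω} [IsProbabilityMeasure P]

/-- **CDHKS §3, from the observable martingale to the driving martingales (spin case), on a
general probability space.** Let `W` be a real process indexed by `[0, ∞)` with strongly
measurable coordinates, continuous paths and `W_0 = 0`, whose running supremum on each `[0, t]`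
is a.s. dominated by a nonnegative `M ∈ L³` (CDHKS Thm. 3: finite exponential moments), and
suppose that for every `y > 0` the time-limited spin observable `N^y = spinObservableProcess W y`
satisfies the cylinder identity `E[(N^y_t - N^y_s) ψ(W_{S_0}, …, W_{S_{n-1}})] = 0` for all
`s ≤ t`, all finite families of times `S_k ≤ s` and all continuous `ψ` with `|ψ| ≤ 1` (the
monotone-class form of "`M_t(z)`, `t ≤ T(z)`, is a martingale with respect to the filtration
generated by `W_t`"). Then **`W_t` and `W_t² - 3t` are martingales in the natural filtration of
`W`** (CDHKS: "both coefficients `W_t` and `W_t² - 3t` are martingales"). PROVED: natural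
martingales (`martingale_re_im_spinObservableProcess_of_cylinder`), optional stopping at `τ_y`
(`martingale_re_stoppedSpinObservable`, `martingale_im_stoppedSpinObservable`), and the tree's
extraction theorem `martingale_driver_of_spinObservable` with `y₀ = 1`.
[cite: CDHKSCRAS2014, §3 (proof of Thm. 1, last paragraph)] -/
theorem martingale_driver_of_spinCylinderIdentity (hW : ∀ t, StronglyMeasurable (W t))
    (hWc : ∀ ω, Continuous (W · ω)) (hW0 : ∀ ω, W 0 ω = 0)
    (hmom : ∀ t : ℝ≥0, ∃ M : Ω → ℝ, MemLp M 3 P ∧ (∀ ω, 0 ≤ M ω) ∧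
      ∀ᵐ ω ∂P, ∀ u, u ≤ t → |W u ω| ≤ M ω)
    (hcyl : ∀ y : ℝ, 0 < y → ∀ s t : ℝ≥0, s ≤ t → ∀ (n : ℕ) (S : Fin n → ℝ≥0), (∀ k, S k ≤ s) →
      ∀ ψ : (Fin n → ℝ) → ℝ, Continuous ψ → (∀ v, |ψ v| ≤ 1) →
        ∫ ω, (spinObservableProcess W y t ω - spinObservableProcess W y s ω) *
          (ψ (fun k ↦ W (S k) ω) : ℂ) ∂P = 0) :
    Martingale W (Filtration.natural W hW) P ∧
      Martingale (fun t ω ↦ W t ω ^ 2 - 3 * (t : ℝ)) (Filtration.natural W hW) P := by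
  have hWad : StronglyAdapted (Filtration.natural W hW) W := Filtration.stronglyAdapted_natural hW
  refine martingale_driver_of_spinObservable hWad hWc hW0 hmom (y₀ := 1) (fun y hy ↦ ?_)
    (fun y hy ↦ ?_)
  · have hy0 : 0 < y := by linarith
    exact martingale_re_stoppedSpinObservable hWad hWc hW0 hy0
      (martingale_re_im_spinObservableProcess_of_cylinder hW hWc hy0 (hcyl y hy0)).1
  · have hy0 : 0 < y := by linarith
    exact martingale_im_stoppedSpinObservable hWad hWc hW0 hy0
      (martingale_re_im_spinObservableProcess_of_cylinder hW hWc hy0 (hcyl y hy0)).2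

end Assembly

end Loewner

end Literature.Probability.RandomPlanarGeometry
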